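import Mathlib.Analysis.SpecialFunctions.Pow.Real
import Mathlib.Analysis.SpecialFunctions.Log.Basic

/-!
# Giorgi–Klainerman–Szeftel, *Wave equations estimates and the nonlinear stability of slowly rotating Kerr black holes*: the principal estimates of Parts I–II, typed as statement shapes

CITATION HEADER (lean-in-tree rule 2026-08-18).  This module types, at STATEMENT LEVEL, the principal analytic
estimates of

* E. Giorgi, S. Klainerman, J. Szeftel, arXiv:2205.14808 (v1 = the only arXiv version, 30 May 2022; TeX source
  `FinalKerrarxivversion.tex`, whose line numbers `GKS l.N` are quoted) = bib key `GiorgiKlainermanSzeftel2022`;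
  journal record Pure Appl. Math. Q. **20** (2024) no. 7, 2865–3849 = bib key `GiorgiKlainermanSzeftel2024`
  (refereed), read in the authors' version HAL hal-05348127v1 (dated 10 Sep 2024; pages quoted `HAL p.N`, theorem
  numbers `journal Thm x.y.z`).  For every statement typed HERE the journal number equals the arXiv number and the
  displayed estimate is verbatim the same, EXCEPT "Theorem M2": arXiv Thm 12.4.4 = journal Thm 12.4.5 (a Remark 12.4.4
  on the r-foliation assumptions was inserted).  The audit cell's CONCORDANCE.md has the full table.
* S. Klainerman, J. Szeftel, *Kerr stability for small angular momentum*, arXiv:2104.11857 (v1; TeX `Main-Kerr-arxiv.tex`,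
  lines `KS l.N`) = bib key `KlainermanSzeftel2021`; journal record Pure Appl. Math. Q. **19** (2023) 791–1678 = bib key
  `KlainermanSzeftel2023` — only for the parameter conventions of §0 and the wording of Theorems M1/M2.
* Comparison statements NAMED in docstrings for the `|a|`-census (their content is typed, if at all, in the companion
  module `CurvatureEstimateShapes`): Dafermos–Holzegel–Rodnianski, Acta Math. / Ann. PDE 2019 (bib key
  `DafermosHolzegelRodnianski2019`, arXiv:1711.07944); Shlapentokh-Rothman–Teixeira da Costa arXiv:2007.07211 /
  2302.08916 (`ShlapentokhrothmanCosta2020`, `ShlapentokhrothmanCosta2023`); Ma–Szeftel arXiv:2410.02341 (`MaSzeftel2024`,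
  preprint), arXiv:2603.23437 (`MaSzeftel2026`, preprint).

WHAT IS REPRODUCED, and in what sense.  GKS Theorems 6.2.1, 6.2.2, 6.3.1 (Part I, the model generalised Regge–Wheeler
equation (6.1.1)), 11.2.3, 11.6.1, 11.6.2, 11.7.1 (= "Theorem M1 of KS"), 12.2.4, 12.4.4/journal 12.4.5 (= "Theorem M2
of KS") become `def … : Prop` STATEMENT SHAPES over abstract carriers (`GRWData`, `TeukData`, `TeukBarData`: a type of
admissible (spacetime, solution, source) configurations plus the norm functionals GKS defines on them — `E_p^s`, `B_p^s`,
`F_p^s`, `N_p^s`, `BEF_p^s`, … — as real-valued functions), with EXPLICIT parameters: which ranges of `p, q, s`, which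
decay exponents, the loss of derivatives, and an explicit constant `K` in place of every `≲`.  The quantifier shapes of
§1 (`SmallAForm`, `FullRangeForm`, `ExactKerr…Form`) make precise what "`|a|/m ≪ 1` only" versus "full subextremal
range" MEANS; which shape each estimate has IN PRINT is recorded in the docstrings (tag `PUBLISHED RANGE`) and in the
`census` list of the companion module — it is never asserted as a theorem.  NAMED-FACT SEMANTICS DO NOT APPLY: over an
arbitrary carrier none of these Props is a theorem, so no `_holds` discharge is expected (D-0026 debt accounting does
not apply); the `[cite: …]` tags record the PROVENANCE of each shape (which display it transcribes, TeX line + journal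
page), not a claim.  What IS proved here (zero `sorry`, axioms ⊆ {propext, Classical.choice, Quot.sound}) is elementary:
`SmallAForm.of_fullRange`, `ExactKerrSmallAForm.of_fullRange`, `SmallAForm.mono` (the census classes are ordered).

STATUS OF THE SOURCE.  GKS is a refereed publication; this module neither re-proves nor disputes any of its estimates.
It was written by the audit cell `pub-kerr` (Final State Conjecture near-miss cell: typed skeleton + `|a| ≪ M` census of
the Klainerman–Szeftel / Giorgi–Klainerman–Szeftel proof), whose rule is that the manuscripts under audit enter only as
explicit hypotheses.  Typing choices that simplify the print (cell file DIVERGENCE.md): (a) `Small.WF` asks `ε₀ ≤ ε ≤ 1`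
(true for KS's `ε = ε₀^{2/3}`, `ε₀ ≤ 1`; the relation `ε = ε₀^{2/3}` itself is NOT typed — nothing below needs it);
(b) the `ExactKerr…Form` shapes encode "linear problem on exact Kerr" by the MODELLING CONVENTION `S.ε = S.ε0` (the
bootstrap smallness plays no role) — no counterpart in the TeX of DHR / SRTdC; (c) geometry is abstracted entirely:
interpreting the functionals by actual integrals on a GCM-admissible spacetime is not done anywhere in the tree.

RELATION TO EXISTING TREE MATERIAL (reviewers please note).  `Literature.Geometry.Lorentzian.KlainermanSzeftel2021.
Bootstrap` types the KS ch. 3 / §9.4 ARCHITECTURE over its own carrier (`Constants`, `Setting`); the records `KerrParams`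
/ `Fixed` / `Small` below are the GKS-side parameters (δ, δ_dec, δ_B, k_L, r₀; ε₀, ε, τ_*) and are deliberately NOT
`Bootstrap.Constants` (k_small/k_large, u_*-based) — a dictionary between the two is a separate, unlanded item of the cell.
`Sweep2.lean` (`srtdc_teukolsky_*`, `dhr_teukolsky_*_small_a`) states the DHR / SRTdC Teukolsky theorems on the exact
Kerr–Schild chart as named facts; `KerrStabilitySubextremalCauchy.lean` carries the Hintz 2026 claim; `StabilityCauchy.lean`
the KS end-statement.  Nothing below restates any of them (different carriers, no metric), and nothing here is
Final-State-Conjecture progress.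

STAGING.  = §0–§3 of the cell's staged module `KerrSkeleton/Estimates.lean` v1 (namespace `KerrSkeleton.Estimates`, md5
8c65817e…, clean-built in the staging package 2026-08-18), code unchanged except: namespace moved under the path,
docstrings completed (journal locators) and provenance tags added.  §4–§7 (Part III curvature estimates, the absorption
arithmetic, the census list, the Ma–Szeftel comparison shape) are the companion module `CurvatureEstimateShapes`.

## Contents
* §0 `KerrParams`, `Fixed`, `Fixed.WF`, `Small`, `Small.WF` — parameters;
* §1 `Schema`, `SmallAForm`, `FullRangeForm`, `ExactKerrFullRangeForm`, `ExactKerrSmallAForm`, the three ordering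
  theorems, `ARange` (census tags);
* §2 Part I: `GRWData`, `TimeOK`, `GenRW1P` (Thm 6.2.1), `GenRW2Q` (Thm 6.2.2), `MorawetzEnergyModel` (Thm 6.3.1);
* §3 Part II: `TeukData`, `rp`, `NondegMorawetzQf` (Thm 11.2.3), `NondegMorawetzQfStrong` (11.6.1), `GRW1PStrongPsic`
  (11.6.2), `TheoremM1_GKS` (11.7.1), `TeukBarData`, `NondegMorawetzQfb` (12.2.4), `TheoremM2_GKS` (12.4.4 / j12.4.5).
-/

noncomputable section

namespace Literature.Geometry.Lorentzian.GiorgiKlainermanSzeftel2022.EstimateShapes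

/-! ## §0 Parameters -/

/-- Reference Kerr parameters `(m, a)`, subextremal: `0 < m`, `|a| < m`.
[cite: KlainermanSzeftel2021, §3.4.1 (0 ≤ |a₀| < m₀), TeX l.6075–6092] -/
structure KerrParams where
  m : ℝ
  a : ℝ
  m_pos : 0 < m
  subextremal : |a| < m

/-- Constants fixed BEFORE the smallness constants: the small loss parameter `δ` of the `p`-ranges (`δ ≤ p ≤ 2-δ`,
GKS Thm 6.2.1), `δ_dec` (KS l.6075–6092; GKS (11.1.1) l.20246), `δ_B` (the `r`-weight split `r^{3±δ_B}` of the curvature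
norms, KS (9.4.7)–(9.4.9) l.23981–24010), the top regularity `k_L` (GKS (6.1.6) l.9674: "k_L is an unspecified large
positive integer"; = k_small+120 in Part II, l.20240–20251), and the radius `r₀` separating `M_int`/`M_ext` (KS §9.4.1
l.23857ff; GKS §13.5 l.25671ff = journal §13.5, HAL p.620ff).
[cite: GiorgiKlainermanSzeftel2022, (6.1.6) and §13.5 (the fixed constants δ, δ_dec, δ_B, k_L, r₀), TeX l.9674, l.25671ff] -/
structure Fixed where
  δ : ℝ
  δdec : ℝ
  δB : ℝ
  kL : ℕ
  r0 : ℝ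

/-- Well-formedness of the fixed constants (all we use: positivity, `δ < 1`, `r₀ ≥ 1`); a typing device. [folklore] -/
def Fixed.WF (F : Fixed) : Prop :=
  0 < F.δ ∧ F.δ < 1 ∧ 0 < F.δdec ∧ 0 < F.δB ∧ 1 ≤ F.r0

/-- The smallness data: `ε₀` (initial data), `ε` (bootstrap), and the final time `τ_*` (resp. `u_*`) of the bootstrap
region.  KS l.6075–6092: `ε₀, ε ≪ min(m₀-|a₀|,1)`, `ε = ε₀^{2/3}`; GKS works on `M = M(1, τ_*)`.
[cite: KlainermanSzeftel2021, §3.4.1 smallness constants ε₀, ε, TeX l.6075–6092] -/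
structure Small where
  ε0 : ℝ
  ε : ℝ
  τstar : ℝ

/-- Well-formedness of the smallness data: `0 < ε₀ ≤ ε ≤ 1`, `1 ≤ τ_*` (typing device; `ε = ε₀^{2/3}` is NOT encoded).
[folklore] -/
def Small.WF (S : Small) : Prop :=
  0 < S.ε0 ∧ S.ε0 ≤ S.ε ∧ S.ε ≤ 1 ∧ 1 ≤ S.τstar

/-! ## §1 Quantifier shapes = the meaning of the |a|-census classes

An estimate *schema* is a Prop depending on the parameters and on the explicit constant `K` that the source hides in
`≲`.  The two shapes below differ ONLY in where `|a|` is bounded: uniformly small (`|a| ≤ α₀·m`, `α₀` independent of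
`a`) versus any `a₀ < m` with all later constants allowed to depend on `a₀`. -/

/-- An estimate schema: parameters ↦ hidden constant ↦ Prop (typing device). [folklore] -/
abbrev Schema : Type := KerrParams → Fixed → Small → ℝ → Prop

/-- "|a|/m ≪ 1 ONLY" as published: for every `m>0` and fixed constants there are a UNIFORM `α₀>0`, a smallness
threshold `ε'` and a constant `K` such that the estimate holds whenever `|a| ≤ α₀ m`, `ε ≤ ε'`.  (`α₀` may depend on `m`
and on `F` — e.g. on `r₀` — but not on the solution, `ε`, `τ_*`.)  This is the quantifier shape of the GKS Main Theorem
("for sufficiently small |a₀|/m₀", GKS l.1302 = journal §1.1) read estimate by estimate; a typing device. [folklore] -/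
def SmallAForm (E : Schema) : Prop :=
  ∀ m : ℝ, 0 < m → ∀ F : Fixed, F.WF →
    ∃ α0 : ℝ, 0 < α0 ∧ ∃ ε' : ℝ, 0 < ε' ∧ ∃ K : ℝ, 0 < K ∧
      ∀ (P : KerrParams) (S : Small), P.m = m → |P.a| ≤ α0 * m → S.WF → S.ε ≤ ε' → E P F S K

/-- "FULL SUBEXTREMAL RANGE" as published elsewhere (Ma–Szeftel 2024 Thm 1.4 (rough) / Thm 4.1; Ma–Szeftel 2026 Thm 1.2
(rough) / Thm 7.1; Shlapentokh-Rothman–Teixeira da Costa Thm A with ε = 0): for every `a₀ < m` there are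
`ε' = ε'(m,a₀,F)` and `K = K(m,a₀,F)` (degenerating as `a₀ → m`).  Typing device. [folklore] -/
def FullRangeForm (E : Schema) : Prop :=
  ∀ m : ℝ, 0 < m → ∀ a0 : ℝ, 0 ≤ a0 → a0 < m → ∀ F : Fixed, F.WF →
    ∃ ε' : ℝ, 0 < ε' ∧ ∃ K : ℝ, 0 < K ∧
      ∀ (P : KerrParams) (S : Small), P.m = m → |P.a| ≤ a0 → S.WF → S.ε ≤ ε' → E P F S K

/-- EXACT-KERR (linear, `ε = 0`) full-range shape: Shlapentokh-Rothman–Teixeira da Costa Theorem A (arXiv:2302.08916 TeX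
l.355–364), DHR with `a₀` small.  The perturbation size plays no role (modelling convention `S.ε = S.ε0`); constants
depend on `(M, |a|, s)` resp. `a₀`.  Typing device. [folklore] -/
def ExactKerrFullRangeForm (E : Schema) : Prop :=
  ∀ m : ℝ, 0 < m → ∀ a0 : ℝ, 0 ≤ a0 → a0 < m → ∀ F : Fixed, F.WF →
    ∃ K : ℝ, 0 < K ∧ ∀ (P : KerrParams) (S : Small), P.m = m → |P.a| ≤ a0 → S.WF → S.ε = S.ε0 → E P F S K

/-- EXACT-KERR, `|a| ≪ M` shape: DHR Theorem 4.1 (`finalstatetheor`, first theorem of §4, arXiv:1711.07944 TeX l.2367–2391;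
rough version l.487–495: "Let |a| ≪ M").  Typing device. [folklore] -/
def ExactKerrSmallAForm (E : Schema) : Prop :=
  ∀ m : ℝ, 0 < m → ∀ F : Fixed, F.WF →
    ∃ α0 : ℝ, 0 < α0 ∧ ∃ K : ℝ, 0 < K ∧
      ∀ (P : KerrParams) (S : Small), P.m = m → |P.a| ≤ α0 * m → S.WF → S.ε = S.ε0 → E P F S K

/-- The census classes are ordered: a full-range statement implies the small-|a| statement of the same schema (take
`a₀ = m/2`, `α₀ = 1/2`).  Kernel-checked; this is what licenses "rung +1 supersedes rung 0" item by item in the cell's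
census. [folklore] -/
theorem SmallAForm.of_fullRange {E : Schema} (h : FullRangeForm E) : SmallAForm E := by
  intro m hm F hF
  obtain ⟨ε', hε', K, hK, hE⟩ := h m hm (m / 2) (by positivity) (by linarith) F hF
  refine ⟨1 / 2, by norm_num, ε', hε', K, hK, ?_⟩
  intro P S hPm ha hS hε
  exact hE P S hPm (by linarith) hS hε

/-- Exact-Kerr version of the ordering: full range ⟹ small |a|. [folklore] -/
theorem ExactKerrSmallAForm.of_fullRange {E : Schema} (h : ExactKerrFullRangeForm E) :
    ExactKerrSmallAForm E := by
  intro m hm F hF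
  obtain ⟨K, hK, hE⟩ := h m hm (m / 2) (by positivity) (by linarith) F hF
  refine ⟨1 / 2, by norm_num, K, hK, ?_⟩
  intro P S hPm ha hS hε
  exact hE P S hPm (by linarith) hS hε

/-- Monotonicity in the schema (weakening the conclusion preserves the shape). [folklore] -/
theorem SmallAForm.mono {E E' : Schema} (hEE' : ∀ P F S K, E P F S K → E' P F S K)
    (h : SmallAForm E) : SmallAForm E' := by
  intro m hm F hF
  obtain ⟨α0, hα0, ε', hε', K, hK, hE⟩ := h m hm F hF
  exact ⟨α0, hα0, ε', hε', K, hK, fun P S h1 h2 h3 h4 => hEE' P F S K (hE P S h1 h2 h3 h4)⟩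

/-- Which range of `|a|` the PUBLISHED proof of an estimate covers (census tag; a bookkeeping device of the audit,
not a notion of any source). [folklore] -/
inductive ARange
  | allSubextremal      -- valid for all |a| < m with an argument for a-uniform constants (reserved for the census; unused here)
  | noSmallnessPrinted  -- own proof prints no |a|-smallness and cites no smallOnly input (grep evidence in the
                        -- docstring); a-uniformity of the hidden constant is NOT argued in print — the census decides
  | smallOnly           -- the printed proof uses |a|/m ≪ 1 (SmallAForm)
  | smallOnlyImplicit   -- statement carries no a-restriction but its proof invokes a smallOnly input
  | exactKerrFull       -- linear statement on exact Kerr, |a| < M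
  | exactKerrSmall      -- linear statement on exact Kerr, |a| ≪ M
  | pertKerrFull        -- perturbations of Kerr, full |a| < m (published elsewhere: Ma–Szeftel 2024/2026)
  deriving DecidableEq, Repr

/-! ## §2 Part I of GKS: the model gRW equation (Chapters 6–10; journal chapters 6–10, same numbering)

Equation (6.1.1) [GKS l.9566 = journal (6.1.1), HAL p.211]:  `□₂ψ − Vψ = −(4a cosθ/|q|²) *∇_T ψ + N`,
`V = 4Δ/((r²+a²)|q|²)`, `ψ ∈ 𝔰₂`, on a spacetime `M = M(1,τ_*)` satisfying (6.1.6) [l.9674]: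
  `r³|𝔡^{≤k}ξ| + r²|𝔡^{≤k}Γ_g| + r|𝔡^{≤k}Γ_b| ≤ ε (k ≤ k_L)`,  `… ≤ ε τ_trap^{-1-δ_dec} (k ≤ k_L/2)`.
Norms §6.1.5 [l.9891–10005]: E[ψ](τ), F = F_A + F_{Σ_*}, Mor, N[ψ,N], and for 0<p<2 the r^p-weighted B_p, E_p, F_p, N_p;
combined BEF_p = sup_τ E_p + B_p + F_p; higher order Q^s = Σ_{k≤s} Q[𝔡^k ψ]. -/

/-- Abstract carrier for the Part I estimates at given parameters.  `Sol` = admissible triples (M satisfying (6.1.6) with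
the current ε, ψ ∈ 𝔰₂(M) solving (6.1.1), N); the functionals are GKS §6.1.5 (index conventions: `p : ℝ` weight, `s : ℕ`
number of derivatives, `τ, τ₁, τ₂ : ℝ`).
[cite: GiorgiKlainermanSzeftel2022, §6.1.5 norms (items 1–11), TeX l.9891–10005; journal §6.1.5, HAL p.216–219] -/
structure GRWData where
  Sol : Type
  /-- `E p s ψ τ = E_p^s[ψ](τ)` (item 6 + item 11, l.9957–9966, 9996–10001). -/
  E : ℝ → ℕ → Sol → ℝ → ℝ
  /-- `B p s ψ τ₁ τ₂ = B_p^s[ψ](τ₁,τ₂)` (item 5, l.9950–9953): Morawetz bulk + r^{p-3}-weighted bulk on r ≥ 4m. -/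
  B : ℝ → ℕ → Sol → ℝ → ℝ → ℝ
  /-- `F p s ψ τ₁ τ₂ = F_p^s[ψ](τ₁,τ₂)` (item 7, l.9973–9977): fluxes through 𝒜 and Σ_*. -/
  F : ℝ → ℕ → Sol → ℝ → ℝ → ℝ
  /-- `N p s ψ τ₁ τ₂ = N_p^s[ψ,N](τ₁,τ₂)` (items 4 and 9, l.9937–9944, 9990–9993). -/
  N : ℝ → ℕ → Sol → ℝ → ℝ → ℝ
  /-- unweighted `E^s[ψ](τ)`, `F^s`, `N^s` and `Mor^s` (items 1–4), used by Thm 6.3.1. -/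
  E0 : ℕ → Sol → ℝ → ℝ
  F0 : ℕ → Sol → ℝ → ℝ → ℝ
  N0 : ℕ → Sol → ℝ → ℝ → ℝ
  /-- LHS of Thm 6.3.1: `Mor[(∇₃,∇₄,𝔡̸)^{≤s}ψ](τ₁,τ₂) + E[(…)^{≤s}ψ](τ₂) + F[(…)^{≤s}ψ](τ₁,τ₂)`. -/
  MorEF : ℕ → Sol → ℝ → ℝ → ℝ
  /-- norms of `ψ̌ := f₂(e₄ψ + r|q|⁻²ψ)`, `f₂ = r²` for r ≥ R (Thm 6.2.2): `Ec q s`, `Bc`, `Fc`, `Nc` (= E_q^s[ψ̌], …, Ñ_q^s[ψ̌,N]). -/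
  Ec : ℝ → ℕ → Sol → ℝ → ℝ
  Bc : ℝ → ℕ → Sol → ℝ → ℝ → ℝ
  Fc : ℝ → ℕ → Sol → ℝ → ℝ → ℝ
  Nc : ℝ → ℕ → Sol → ℝ → ℝ → ℝ

/-- The admissible time arguments: `1 ≤ τ₁ ≤ τ ≤ τ₂ ≤ τ_*` (GKS: "for all 1 ≤ τ₁ < τ₂ ≤ τ_*"; typing device). [folklore] -/
def TimeOK (S : Small) (τ1 τ τ2 : ℝ) : Prop := 1 ≤ τ1 ∧ τ1 ≤ τ ∧ τ ≤ τ2 ∧ τ2 ≤ S.τstar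

/-- **E1 = GKS Theorem 6.2.1** (`THEOREM:GENRW1-P`, TeX l.10020–10028; intro twin Thm 1.6.4 l.1989–2008; journal Thm 6.2.1,
HAL p.220), "Basic r^p-weighted estimates": for all `δ ≤ p ≤ 2-δ`, `2 ≤ s ≤ k_L`,
`sup_{τ∈[τ₁,τ₂]} E_p^s[ψ](τ) + B_p^s[ψ](τ₁,τ₂) + F_p^s[ψ](τ₁,τ₂) ≲ E_p^s[ψ](τ₁) + N_p^s[ψ,N](τ₁,τ₂)`.
Loss of derivatives: none in `s` (same `s` both sides).  Constant: depends on `m, δ, k_L` (hidden).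
PUBLISHED RANGE: smallOnlyImplicit — the statement has no a-restriction, but its proof (Ch. 10, l.18658ff) invokes Thm 6.3.1
which is stated "for |a|/m ≪ 1".  Statement shape, not asserted.
[cite: GiorgiKlainermanSzeftel2022, Thm 6.2.1, TeX l.10020–10028; journal GiorgiKlainermanSzeftel2024 Thm 6.2.1, HAL p.220] -/
def GenRW1P (X : GRWData) (_P : KerrParams) (F : Fixed) (S : Small) (K : ℝ) : Prop :=
  ∀ (ψ : X.Sol) (p : ℝ) (s : ℕ) (τ1 τ τ2 : ℝ),
    F.δ ≤ p → p ≤ 2 - F.δ → 2 ≤ s → s ≤ F.kL → TimeOK S τ1 τ τ2 →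
      X.E p s ψ τ + X.B p s ψ τ1 τ2 + X.F p s ψ τ1 τ2 ≤ K * (X.E p s ψ τ1 + X.N p s ψ τ1 τ2)

/-- **E2 = GKS Theorem 6.2.2** (`THEOREM:GENRW2-Q`, l.10037–10058; journal Thm 6.2.2, HAL p.220), "Improved r^p-weighted
estimates" for `ψ̌ = f₂(e₄ψ + r|q|⁻²ψ)`: for `-1+δ < q ≤ 1-δ`, `s ≤ k_L - 1`,
`BEF_q^s[ψ̌] ≲ E_q^s[ψ̌](τ₁) + E^{s+1}_{max(q,δ)}[ψ](τ₁) + Ñ_q^s[ψ̌,N] + N^{s+1}_{max(q,δ)}[ψ,N]`.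
Loss: one derivative of ψ (s+1 on the right).  PUBLISHED RANGE: smallOnlyImplicit (via Thm 6.2.1/6.3.1).  Statement shape.
[cite: GiorgiKlainermanSzeftel2022, Thm 6.2.2, TeX l.10037–10058; journal GiorgiKlainermanSzeftel2024 Thm 6.2.2, HAL p.220] -/
def GenRW2Q (X : GRWData) (_P : KerrParams) (F : Fixed) (S : Small) (K : ℝ) : Prop :=
  ∀ (ψ : X.Sol) (q : ℝ) (s : ℕ) (τ1 τ τ2 : ℝ),
    -1 + F.δ < q → q ≤ 1 - F.δ → s + 1 ≤ F.kL → TimeOK S τ1 τ τ2 →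
      X.Ec q s ψ τ + X.Bc q s ψ τ1 τ2 + X.Fc q s ψ τ1 τ2 ≤
        K * (X.Ec q s ψ τ1 + X.E (max q F.δ) (s + 1) ψ τ1
              + X.Nc q s ψ τ1 τ2 + X.N (max q F.δ) (s + 1) ψ τ1 τ2)

/-- **E3 = GKS Theorem 6.3.1** (`THM:HIGHERDERIVS-MORAWETZ-CHP3`, l.10079–10087; journal Thm 6.3.1, HAL p.221), "Morawetz–Energy":
"For |a|/m ≪ 1 sufficiently small, for all 2 ≤ s ≤ k_L and any δ>0,
 Mor[(∇₃,∇₄,𝔡̸)^{≤s}ψ] + E[(…)^{≤s}ψ](τ₂) + F[(…)^{≤s}ψ]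
   ≲ E^s[ψ](τ₁) + N^s[ψ,N] + (|a|/m + ε)(sup_τ E^s[ψ] + B_δ^s[ψ] + F^s[ψ])".
The `(|a|/m + ε)`-term is EXPLICIT in the source; it is absorbed only after combination with the r^p estimates (Ch. 10).
PUBLISHED RANGE: smallOnly (explicit in the statement).  Mechanisms in the proof (§6.3.2, each marked in the source; same
numbers in the journal, HAL p.224–228): Prop 6.3.7(2) Poincaré/Hardy absorption of the zero-order term "|a|/m ≪ 1"
(l.10262–10286; part (1) is stated for all |a|/m<1); Prop 6.3.9 energy estimate with `T̂_δ`, de-trapping Lemma 6.1.12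
(l.9845; journal "for |a|/m sufficiently small and δ_trap = 1/10", HAL p.216), error `(|a|/m)·Mor^{ax}_{deg}` (l.10319–10328);
Prop 6.3.10 𝒮-commuted (Andersson–Blue) Morawetz with error `(|a|/m)·B_δ²` (l.10347–10367); Lemma 6.3.11 lower bound for Φ_z
outside M_trap "|a|/m ≪ δ₀" (l.10391–10403).  Statement shape, not asserted.
[cite: GiorgiKlainermanSzeftel2022, Thm 6.3.1, TeX l.10079–10087; journal GiorgiKlainermanSzeftel2024 Thm 6.3.1, HAL p.221] -/
def MorawetzEnergyModel (X : GRWData) (P : KerrParams) (F : Fixed) (S : Small) (K : ℝ) : Prop :=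
  ∀ (ψ : X.Sol) (s : ℕ) (τ1 τ τ2 : ℝ),
    2 ≤ s → s ≤ F.kL → TimeOK S τ1 τ τ2 →
      X.MorEF s ψ τ1 τ2 ≤
        K * (X.E0 s ψ τ1 + X.N0 s ψ τ1 τ2)
        + K * (|P.a| / P.m + S.ε) * (X.E0 s ψ τ + X.B F.δ s ψ τ1 τ2 + X.F0 s ψ τ1 τ2)

/-! ## §3 Part II of GKS: Teukolsky / full gRW for (𝔮, A) and (𝔮̲, A̲) (Chapters 11–12); Theorems M1, M2

Hypotheses of Chapter 11 (l.20240–20262 = journal §11.1, HAL p.478–479): (11.1.1) `(r²τ^{1/2+δ_dec} + rτ^{1+δ_dec})|𝔡^{≤k}Γ_g| ≤ ε`,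
`rτ^{1+δ_dec}|𝔡^{≤k}Γ_b| ≤ ε`, `k ≤ k_L = k_small + 120`; (11.1.2) `r^{7/2+δ_dec}(|𝔡^{≤k}A|+|𝔡^{≤k}B|) ≤ ε`;
frame: `Ȟ ∈ Γ_g`, `r³|𝔡^{≤k}Ξ| ≤ ε`.  `N_err = N_g + ∇₃(rN_g) + N_m[𝔮]` (l.22271–22276; journal (11.1.11), HAL p.523). -/

/-- Carrier for the (ψ = ℜ𝔮, A) system of Chapter 11 and its check-quantity ψ̌ = r²(∇₄ψ + r|q|⁻²ψ).
[cite: GiorgiKlainermanSzeftel2022, §11.2.2 combined norms for (ψ, A), TeX l.20507ff; journal §11.2.2, HAL p.483] -/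
structure TeukData where
  Sol : Type
  /-- `BEF p s x τ₁ τ₂ = BEF_p^s[ψ,A](τ₁,τ₂)` (§11.2.2 "Combined norms for ψ, A", l.20507ff). -/
  BEF : ℝ → ℕ → Sol → ℝ → ℝ → ℝ
  /-- `E p s x τ = E_p^s[ψ,A](τ)`. -/
  E : ℝ → ℕ → Sol → ℝ → ℝ
  /-- `Nerr p s x τ₁ τ₂ = N_p^s[ψ, N_err](τ₁,τ₂)`. -/
  Nerr : ℝ → ℕ → Sol → ℝ → ℝ → ℝ
  /-- check quantity: `BEFc q s`, `Ec q s` = BEF_q^s[ψ̌], E_q^s[ψ̌]. -/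
  BEFc : ℝ → ℕ → Sol → ℝ → ℝ → ℝ
  Ec : ℝ → ℕ → Sol → ℝ → ℝ
  /-- Theorem M1 quantities: a type of spacetime points with coordinate functions `r`, `τ`, and the pointwise size
  `dA s x pt = |𝔡^{≤s}A| + r|𝔡^{≤s-1}∇₃A|` at `pt`; the Σ_*-flux `fluxSig s x τ = ∫_{Σ_*(≥τ)} |∇₃𝔡^{s-1}ψ|²`. -/
  Pt : Type
  r : Pt → ℝ
  τ : Pt → ℝ
  dA : ℕ → Sol → Pt → ℝ
  fluxSig : ℕ → Sol → ℝ → ℝ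

/-- Real power `x^y` for real exponents (Mathlib `Real.rpow`), used for the decay factors `τ^{-2-3δ_dec}` etc. [folklore] -/
abbrev rp (x y : ℝ) : ℝ := Real.rpow x y

/-- **E9 = GKS Theorem 11.2.3** (`Thm:Nondegenerate-Morawetz`, l.20568–20576; journal Thm 11.2.3, (11.2.1), HAL p.483): for
`δ ≤ p ≤ 2-δ`, `2 ≤ s ≤ k_L`,  `BEF_p^s[ψ,A](τ₁,τ₂) ≲ E_p^s[ψ,A](τ₁) + N_p^s[ψ,N_err](τ₁,τ₂) + ε₀² τ₁^{-2-3δ_dec}`.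
PUBLISHED RANGE: smallOnly — Step 3 of the proof (l.20604–20667: Lemma 11.2.7 produces `|a|·BEF_δ^s[ψ,A]`, absorbed "using
the smallness of |a|/m"; Prop 11.2.8 transport estimates for A).  Statement shape, not asserted.
[cite: GiorgiKlainermanSzeftel2022, Thm 11.2.3, TeX l.20568–20576; journal GiorgiKlainermanSzeftel2024 Thm 11.2.3, HAL p.483] -/
def NondegMorawetzQf (X : TeukData) (_P : KerrParams) (F : Fixed) (S : Small) (K : ℝ) : Prop :=
  ∀ (x : X.Sol) (p : ℝ) (s : ℕ) (τ1 τ2 : ℝ),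
    F.δ ≤ p → p ≤ 2 - F.δ → 2 ≤ s → s ≤ F.kL → 1 ≤ τ1 → τ1 ≤ τ2 → τ2 ≤ S.τstar →
      X.BEF p s x τ1 τ2 ≤
        K * (X.E p s x τ1 + X.Nerr p s x τ1 τ2 + S.ε0 ^ 2 * rp τ1 (-2 - 3 * F.δdec))

/-- **E9s = GKS Theorem 11.6.1** (`Thm:Nondegenerate-Morawetz-strong`, l.22250–22257; journal Thm 11.6.1, (11.6.1), HAL p.523):
after elimination of `N_err`, for `δ ≤ p ≤ 2-δ`, `2 ≤ s ≤ k_L`:  `BEF_p^s[ψ,A](τ₁,τ₂) ≲ E_p^s[ψ,A](τ₁) + ε₀² τ₁^{p-2-3δ_dec}`.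
PUBLISHED RANGE: smallOnlyImplicit (via 11.2.3).  Statement shape, not asserted.
[cite: GiorgiKlainermanSzeftel2022, Thm 11.6.1, TeX l.22250–22257; journal GiorgiKlainermanSzeftel2024 Thm 11.6.1, HAL p.523] -/
def NondegMorawetzQfStrong (X : TeukData) (_P : KerrParams) (F : Fixed) (S : Small) (K : ℝ) : Prop :=
  ∀ (x : X.Sol) (p : ℝ) (s : ℕ) (τ1 τ2 : ℝ),
    F.δ ≤ p → p ≤ 2 - F.δ → 2 ≤ s → s ≤ F.kL → 1 ≤ τ1 → τ1 ≤ τ2 → τ2 ≤ S.τstar →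
      X.BEF p s x τ1 τ2 ≤ K * (X.E p s x τ1 + S.ε0 ^ 2 * rp τ1 (p - 2 - 3 * F.δdec))

/-- **E9c = GKS Theorem 11.6.2** (`theorem:gRW1-p-strong-psiwc`, l.22259–22269; journal Thm 11.6.2, (11.6.2), HAL p.523): for
`2 ≤ s ≤ k_L-1`, `-1+δ ≤ q ≤ 3δ_dec`:  `BEF_q^s[ψ̌] ≲ E_q^s[ψ̌](τ₁) + E^{s+1}_{max(q,δ)}[ψ,A](τ₁) + ε₀² τ₁^{q-3δ_dec}`.
Loss: one derivative.  PUBLISHED RANGE: smallOnlyImplicit.  Statement shape, not asserted.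
[cite: GiorgiKlainermanSzeftel2022, Thm 11.6.2, TeX l.22259–22269; journal GiorgiKlainermanSzeftel2024 Thm 11.6.2, HAL p.523] -/
def GRW1PStrongPsic (X : TeukData) (_P : KerrParams) (F : Fixed) (S : Small) (K : ℝ) : Prop :=
  ∀ (x : X.Sol) (q : ℝ) (s : ℕ) (τ1 τ2 : ℝ),
    -1 + F.δ ≤ q → q ≤ 3 * F.δdec → 2 ≤ s → s + 1 ≤ F.kL → 1 ≤ τ1 → τ1 ≤ τ2 → τ2 ≤ S.τstar →
      X.BEFc q s x τ1 τ2 ≤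
        K * (X.Ec q s x τ1 + X.E (max q F.δ) (s + 1) x τ1 + S.ε0 ^ 2 * rp τ1 (q - 3 * F.δdec))

/-- **E10 = GKS Theorem 11.7.1 = "Theorem M1 in KS"** (`theoremM1:Chap11`, l.22381–22394; journal Thm 11.7.1 "(Theorem M1 in
[56])", HAL p.526; intro Thm 1.5.2, HAL p.44): under the §11.1 assumptions and the data assumption, "if ε₀ is sufficiently small,
there exists δ_extra > δ_dec such that, for all s ≤ k_L - 10,
sup_M ( r²(2r+τ)^{1+δ_extra}/log(1+τ) + r³(2r+τ)^{1/2+δ_extra} )(|𝔡^{≤s}A| + r|𝔡^{≤s-1}∇₃A|) ≲ ε₀ and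
∫_{Σ_*(≥τ)} |∇₃𝔡^{s-1}ψ|² ≲ ε₀² τ^{-2-2δ_extra}".  LOSS OF DERIVATIVES: k_L → k_L-10 (Steps 1–10 of the proof lose one
derivative per mean-value step, l.22396ff).  The INTRO restatement (arXiv Thm 1.5.2, l.1817–1828) prints `k ≤ k_L-20` for the
flux clause — a GKS-internal inconsistency; this def follows the Ch. 11 statement (both ranges cover KS's `k ≤ k_small+100`
since `k_L = k_small+120`).  NOTE (translation node, not an alias): KS Thm M1 (env `thmM1`, KS l.6670–6689) is phrased with
`u`-weights on `M_ext`, `ū` on `M_int ∪ M_top`, `k ≤ k_small+100`, and includes sup bounds for 𝔮.  PUBLISHED RANGE: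
smallOnlyImplicit.  Statement shape, not asserted.
[cite: GiorgiKlainermanSzeftel2022, Thm 11.7.1, TeX l.22381–22394; journal GiorgiKlainermanSzeftel2024 Thm 11.7.1, HAL p.526] -/
def TheoremM1_GKS (X : TeukData) (_P : KerrParams) (F : Fixed) (S : Small) (K : ℝ) : Prop :=
  ∃ δextra : ℝ, F.δdec < δextra ∧
    (∀ (x : X.Sol) (s : ℕ) (pt : X.Pt), s + 10 ≤ F.kL → 1 ≤ X.τ pt → X.τ pt ≤ S.τstar →
        ((X.r pt) ^ 2 * rp (2 * X.r pt + X.τ pt) (1 + δextra) / Real.log (1 + X.τ pt)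
          + (X.r pt) ^ 3 * rp (2 * X.r pt + X.τ pt) (1 / 2 + δextra)) * X.dA s x pt ≤ K * S.ε0) ∧
    (∀ (x : X.Sol) (s : ℕ) (τ : ℝ), s + 10 ≤ F.kL → 1 ≤ τ → τ ≤ S.τstar →
        X.fluxSig s x τ ≤ K * S.ε0 ^ 2 * rp τ (-2 - 2 * δextra))

/-- Carrier for the (ψ̲ = ℜ𝔮̲, A̲) system of Chapter 12 and the Σ_*-fluxes of Theorem M2.
[cite: GiorgiKlainermanSzeftel2022, §12.2 and §12.4.1–12.4.2 (norms, frame and Σ_* assumptions), TeX l.22900ff, l.24140–24270; journal HAL p.551, p.583–584] -/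
structure TeukBarData where
  Sol : Type
  BEF : ℝ → ℕ → Sol → ℝ → ℝ → ℝ
  E : ℝ → ℕ → Sol → ℝ → ℝ
  Nerr : ℝ → ℕ → Sol → ℝ → ℝ → ℝ
  /-- `fluxQf k x τ = ∫_{Σ_*(≥τ)} |∇₃𝔡^k 𝔮|²` (hypothesis (12.4.x) of Thm 12.4.4) and `fluxAb k x τ = ∫_{Σ_*(≥τ)}|𝔡^k α̲|²`. -/
  fluxQf : ℕ → Sol → ℝ → ℝ
  fluxAb : ℕ → Sol → ℝ → ℝ
  /-- the Chapter-12 frame/Σ_* hypotheses (§12.4.1–12.4.2, l.24140–24270; journal (12.4.1)–(12.4.5) + Remark 12.4.4, HAL p.583–584)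
  as an abstract predicate. -/
  frameOK : Sol → Prop

/-- **E11 = GKS Theorem 12.2.4** (`Thm:Nondegenerate-Morawetz-psib`, l.22913–22921; journal Thm 12.2.4, (12.2.2), HAL p.551): for
`s ≤ k_L`, `δ ≤ p ≤ 2-δ`,  `BEF_p^s[ψ̲,A̲](τ₁,τ₂) ≲ E_p^s[ψ̲,A̲](τ₁) + N_p^s[ψ̲,Ñ_err](τ₁,τ₂) + ε₀² τ₁^{-2-2δ_dec}`.
PUBLISHED RANGE: smallOnly — Prop 12.2.5 (l.22938–22947; journal Cor 12.2.5 ff., HAL p.551) carries an explicit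
`O(a)·BEF_p^s[ψ̲,A̲]` term absorbed by smallness of `|a|/m`; transport Prop 12.2.7.  Statement shape, not asserted.
[cite: GiorgiKlainermanSzeftel2022, Thm 12.2.4, TeX l.22913–22921; journal GiorgiKlainermanSzeftel2024 Thm 12.2.4, HAL p.551] -/
def NondegMorawetzQfb (X : TeukBarData) (_P : KerrParams) (F : Fixed) (S : Small) (K : ℝ) : Prop :=
  ∀ (x : X.Sol) (p : ℝ) (s : ℕ) (τ1 τ2 : ℝ),
    F.δ ≤ p → p ≤ 2 - F.δ → s ≤ F.kL → 1 ≤ τ1 → τ1 ≤ τ2 → τ2 ≤ S.τstar →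
      X.BEF p s x τ1 τ2 ≤
        K * (X.E p s x τ1 + X.Nerr p s x τ1 τ2 + S.ε0 ^ 2 * rp τ1 (-2 - 2 * F.δdec))

/-- **E12 = GKS Theorem 12.4.4 (arXiv) = journal Theorem 12.4.5 = "Theorem M2 in KS"** (`thm:restatementofTheoremM2`,
l.24277–24288; journal HAL p.584; intro Thm 1.5.3, HAL p.45): under the Chapter-12 frame assumptions and Σ_*-assumptions, IF
`∫_{Σ_*(≥τ)}|∇₃𝔡^k𝔮|² ≲ ε₀² τ^{-2-2δ_dec}` (from M1) THEN for all `1 ≤ τ ≤ τ_*`, `k ≤ k_L - 7`: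
`∫_{Σ_*(≥τ)}|𝔡^k α̲|² ≲ ε₀² τ^{-2-2δ_dec}`.  LOSS: k_L → k_L-7.  NOTE: KS Thm M2 (env `thmM2`, KS l.6691–6697) bounds
`^{(int)}𝔇_{k_small+80}[α̲] + ^{(top)}𝔇_{k_small+80}[α̲] ≲ ε₀` AND `∫_{Σ_*} u^{2+2δ_dec}|𝔡^kα̲|² ≲ ε₀²`; GKS displays ONLY the
Σ_*-flux.  The interior/top sup-decay clause of KS M2 is therefore an UNSOURCED LEAF in the held texts (cell GAPS.md G-2) —
not typed here.  The flux hypothesis is typed for all `k ≤ k_L` (the TeX leaves the k-range of (12.4.x) implicit): a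
stronger hypothesis, i.e. a weaker statement.  PUBLISHED RANGE: smallOnlyImplicit (via 12.2.4).  Statement shape.
[cite: GiorgiKlainermanSzeftel2022, Thm 12.4.4, TeX l.24277–24288; journal GiorgiKlainermanSzeftel2024 Thm 12.4.5, HAL p.584] -/
def TheoremM2_GKS (X : TeukBarData) (_P : KerrParams) (F : Fixed) (S : Small) (K : ℝ) : Prop :=
  ∀ (x : X.Sol) (K0 : ℝ), X.frameOK x →
    (∀ (k : ℕ) (τ : ℝ), k ≤ F.kL → 1 ≤ τ → τ ≤ S.τstar →
        X.fluxQf k x τ ≤ K0 * S.ε0 ^ 2 * rp τ (-2 - 2 * F.δdec)) →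
    ∀ (k : ℕ) (τ : ℝ), k + 7 ≤ F.kL → 1 ≤ τ → τ ≤ S.τstar →
        X.fluxAb k x τ ≤ K * (1 + K0) * S.ε0 ^ 2 * rp τ (-2 - 2 * F.δdec)

end Literature.Geometry.Lorentzian.GiorgiKlainermanSzeftel2022.EstimateShapes

end
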